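/-
Copyright: the b2b-balaban T⁴-continuum CRUX team, row NE7b owner lineage `t4-ne7b-p1` (gen 115). Project licence.
-/
import Summits.QuantumFields.BalabanUV.T4Continuum.Spine.NE7b.OneShotChartWeightedRows
import Summits.QuantumFields.BalabanUV.T4Continuum.Spine.NE7b.SupSmallFieldBackground

/-!
# THE BACKGROUND RESPONSE AND THE FLUCTUATION COVARIANCE AT THE BACKGROUND ARE EXPONENTIALLY LOCALISED AT THE BLOCK SCALE:
# every `ℓ^∞(ℤ^d)` solution `h` of the linearised constrained system of the perturbed skeleton — `Q′h = v`, `P(Ah + N′h) = κ₀`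
# with `N′` diagonal of size `≤ λ` — obeys the WEIGHTED A-PRIORI LETTER
# `sup_p e^{μρ(blk p)}|h(p)| ≤ (1 − 2λC_Γ(μ))⁻¹·(C_H(μ)·sup_y e^{μρ(y)}|v(y)| + C_Γ(μ)·sup_q e^{μρ(blk q)}|κ₀(q)|)` for every bounded
# 1-Lipschitz coarse weight `ρ` and every rate `0 ≤ μ < min(δ_H, δ_u∕4)` with `2λC_Γ(μ) < 1`; hence (60) v1.1's `Dσ(w)` and `C̃(w)`
# read data supported at coarse distance `≥ D` from `blk p` with weight `≤ K·e^{−μD}` at `p`, uniformly on the interior ball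
# (row NE7b, node U5c; ASE + (62) + (58) + (60) v1.1 BY NAME; the OWNER g114's HANDOFF-FINAL item (i); [folklore])

Cell `pub-balaban`, sub-cell `t4`, spine estimate NE7b (`T4WeightBudget.RelWeightBound`; the cell's OWN estimate — NOT PRINTED in
[Bałaban 1983–89], NOT PROVED).  Crux-route work under `Spine/NE7b/` by the row OWNER (`t4-ne7b-p1` gen 115) under FREEZE (0)'s
crux-prover clause (FILING-CLAIM C-ne7bp1-g115-2); NOTHING of Bałaban's is named as a Lean object, valued or asserted; no
`T4Continuum/Support` leaf typed; no `def`, no notation; zero `sorry`.  Imports (BY NAME): the owner's (62) `…OneShotChartWeightedRows`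
(`weighted_augInverse`, `weighted_blockAvg`, `nonneg_of_weighted`, `lipschitz_trunc_dist`), (60) `…SupSmallFieldBackground` (v1.1:
`exists_background_covariance`; through it leaf-06's ASE `…AugmentedSupEquivalence` — `exists_aug_equiv_sup` with the inverse chart's
action DISPLAYED, `blockAvg_fibreProj` — and the owner's (58) `…LocalNemytskiiSup` — `exists_clm_mul`, `exists_nemytskii`,
`abs_apply_le_norm`).

WHY (located).  (60) v1.1 ∕ (61) v1.1 export the background response `Dσ(w) = A(w)⁻¹∘inl` and the fluctuation covariance
`C̃(w) = A(w)⁻¹∘inr∘P_K` of the perturbed skeleton with their SIZES `(N⁻¹ − c)⁻¹`, `2(N⁻¹ − c)⁻¹`; the next scale's cluster ∕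
localisation expansion consumes their DECAY (PRICING-NE7b v132 F784 (a)).  The Combes–Thomas device needs no conjugated equivalence
and no operator algebra valued in `ker Q′` (the heartbeat sink of record): a solution `h` of the linearised system IS `T⁻¹(v, κ₀ − P(N′h))`
for ASE's free chart `T` (uniqueness is `T⁻¹∘T = 1`), ASE DISPLAYS `T⁻¹`'s action, (62) bounds that displayed action in every weighted
sup norm, and the perturbation column `P∘N′` is weight-neutral up to the factor `2λ` because `N′` is diagonal and `P` is block-local
((62) `weighted_blockAvg`).  With `S := sup_q e^{μρ(blk q)}|h(q)|` (finite: `ρ` bounded, `h ∈ ℓ^∞`) this reads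
`S ≤ C_H‖v‖_{μ,ρ} + C_Γ(‖κ₀‖_{μ,ρ} + 2λS)`, and `2λC_Γ(μ) < 1` closes the bootstrap.  The fibre equation of `Dσ(w)v` is not among
(60) v1.1's displayed letters; §2 derives it by differentiating (60)'s sitewise background equation along `HasFDerivAt σ D w`.

WHAT IS PROVED ([folklore]; `ℓ^∞ := lp (fun _ : X d => ℝ) ∞`; `C_H(μ) := cHs K_d(δ_H − μ)`, `C_Γ(μ) := A_G K_d(δ_u∕4 − μ)(1 + C_H(μ))`
written out; a weight is `ρ : X d → ℝ` with `ρ x − ρ y ≤ dist x y` and `|ρ| ≤ M_ρ`):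
* §1 **`weighted_apriori`** (`d ≥ 3`, `0 ≤ μ < δ_H`, `μ < δ_u∕4`, `2λC_Γ(μ) < 1`): for ANY operators `Q′, A, P` with the displayed
  actions of ASE ∕ (60), any diagonal `N′` (`N′f(p) = g(p)f(p)`, `|g| ≤ λ`) and any `h, v, κ₀ ∈ ℓ^∞` with `Q′κ₀ = 0`, `Q′h = v`,
  `P(Ah + N′h) = κ₀`: `e^{μρ(blk p)}|h(p)| ≤ (1 − 2λC_Γ(μ))⁻¹(C_H(μ)R_v + C_Γ(μ)R_κ)` at every `p`, whenever `e^{μρ(y)}|v(y)| ≤ R_v`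
  and `e^{μρ(blk q)}|κ₀(q)| ≤ R_κ`.  `eq_augInverse_of_solution`: such an `h` IS ASE's displayed `T⁻¹(v, κ₀ − P(N′h))`, sitewise.
* §2 **`fibre_eq_of_hasFDerivAt`**: if `σ` satisfies (60)'s sitewise background equation on a neighbourhood of `w` and
  `HasFDerivAt σ D w`, then `P(A(Dv) + N′(σ w)(Dv)) = 0` for every `v`, `N′(σ w)` = multiplication by `u′∘σ w` ((58) `exists_nemytskii`'s
  `C¹` Nemytskii map, the chain rule, and uniqueness of the derivative of a locally vanishing map).
* §3 **`abs_le_of_far`** — reading a weighted letter as LOCALISATION: if a map `h = L(v, κ₀)` obeys §1's conclusion for every bounded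
  admissible weight, then for data vanishing at coarse distance `< D` from `blk p`: `|h(p)| ≤ K·(C_H R_v + C_Γ R_κ)·e^{−μD}`
  (weight `D − min(dist(·, blk p), D)`, (62) `lipschitz_trunc_dist`).
* §4 **`exists_background_covariance_localised`** (`d ≥ 3`; (60) v1.1's hypotheses verbatim): (60) v1.1's objects and letters
  RE-EXPORTED (`Q′, A, P, N′, σ, C̃` with displayed actions; closed-ball letters; Lipschitz; on the interior ball `∃ D`, `HasFDerivAt σ D w`,
  `‖D‖ ≤ (N⁻¹ − c)⁻¹`, `Q′∘D = 1`; `C̃(w)`'s fibre equation, uniqueness, sizes, modulus) AND NEW on the interior ball: the fibre equation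
  **`P(A(Dv) + N′(σ w)(Dv)) = 0`**, and for every rate `0 ≤ μ < min(δ_H, δ_u∕4)` with `2λC_Γ(μ) < 1` and every bounded admissible `ρ`:
  **`e^{μρ(blk p)}|(Dv)(p)| ≤ (1 − 2λC_Γ(μ))⁻¹C_H(μ)·R_v`** (`e^{μρ}|v| ≤ R_v`) and
  **`e^{μρ(blk p)}|(C̃(w)f)(p)| ≤ (1 − 2λC_Γ(μ))⁻¹·2C_Γ(μ)·R_f`** (`e^{μρ∘blk}|f| ≤ R_f`) — the background response is bounded
  between the WEIGHTED sup spaces and so is the covariance; by §3, both are exponentially localised at the block scale.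

HONEST (what this is NOT).  Constants existential ∕ useless by value (pure-sup currency: by value dead at sides 2, 3 — TCS2, PRICING v131
§4; the mixed currency's weighted twin is not typed); the rate window and the smallness `2λC_Γ(μ) < 1` are symbolic hypotheses (at
`μ = 0` the latter is (60)'s `c < N⁻¹`; continuity in `μ` is not proved here).  Scalar `ℤ^d` skeleton, whole lattice, not the torus, not
the covariant operators ((A3), NC-NE7b-α UNRULED); decay of `σ(w)` itself in `w` beyond linear response, kernel decay of `A(w)⁻¹` as an
operator on `ker Q′`, and anything of Bałaban's (A1c) expansion are NOT here.  BY-NAME EFFECT ON THE WALL: NONE.  NE7b NOT PRINTED ∕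
NOT PROVED; spine PROVED 0∕9; rung (B)+1 on a FINITE torus — NOT infinite volume, NOT the mass gap, NOT Clay.  HONEST DEPENDENCY:
continuum YM on T⁴ ⇐ BetaPertH ∧ nine spine estimates (0∕9 proved); BetaPertH ⇐ (D1) ∧ (D4) ∧ CAP+tail; G-an2-4 gates asym, D1 and NE2∕3∕4.
-/

set_option autoImplicit false

noncomputable section

namespace Summit.QuantumFields.BalabanUV.T4Continuum.NE7b.SupBackgroundLocalisation

open Set Metric Filter
open scoped ENNReal NNReal Topology
open Literature.MathematicalPhysics.QuantumFieldTheory.Balaban1983to89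
open B4Sect5Proof (latticeConst latticeConst_nonneg)
open B6QGQLower276 (X blk B mem_B AX)
open B6QGQDecay237 (deltaU deltaU_pos)
open B5Hk103ScalarZd (Gk nbhd deltaH deltaH_pos)
open B5Hk165L2Zd (HBZd)
open Summit.QuantumFields.BalabanUV.Beta.D1BFx.BlockColumnSupNorm (cHs cHs_nonneg)
open Summit.QuantumFields.BalabanUV.Beta.D1BFx.PointColumnSplit (cKL cG0 cSplit)
open Summit.QuantumFields.BalabanUV.Beta.D1BFx.PointColumnDecay (cFar)
open BlockPropagatorSupNorm (supConstG_nonneg)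
open AugmentedSupEquivalence (exists_aug_equiv_sup blockAvg_fibreProj)
open LocalNemytskiiSup (exists_clm_mul exists_nemytskii abs_apply_le_norm)
open OneShotChartWeightedRows (weighted_augInverse weighted_blockAvg nonneg_of_weighted lipschitz_trunc_dist abs_le_exp_neg_mul)
open SupSmallFieldBackground (exists_background_covariance)

variable {d : ℕ}

/-! ## §1. The weighted a-priori letter for solutions of the linearised constrained system -/

/-- **A solution of the linearised constrained system IS the free chart's inverse applied to the shifted data**: for operators with
the displayed actions and `h, v, κ₀ ∈ ℓ^∞` with `Q′κ₀ = 0`, `Q′h = v`, `P(Ah + N′h) = κ₀` (`N′` = multiplication by `g`), at every site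
`h(p) = T⁻¹(v, κ₀ − P(N′h))(p)` — ASE's displayed inverse of the augmented map, `T⁻¹∘T = 1`. [folklore] -/
theorem eq_augInverse_of_solution (hd : 3 ≤ d) (n : ℕ) {a : ℝ} (ha : 0 < a)
    (Dop Aop Pop Nop : lp (fun _ : X d => ℝ) ∞ →L[ℝ] lp (fun _ : X d => ℝ) ∞)
    (hD : ∀ (f : lp (fun _ : X d => ℝ) ∞) (y : X d), Dop f y = (((n : ℝ) + 1) ^ d)⁻¹ * ∑ p ∈ B n y, f p)
    (hA : ∀ (f : lp (fun _ : X d => ℝ) ∞) (p : X d), Aop f p = ∑ r ∈ nbhd n p, AX n a p r * f r)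
    (hP : ∀ (f : lp (fun _ : X d => ℝ) ∞) (p : X d), Pop f p = f p - (((n : ℝ) + 1) ^ d)⁻¹ * ∑ p' ∈ B n (blk n p), f p')
    (h v κ₀ : lp (fun _ : X d => ℝ) ∞) (hκ₀ : Dop κ₀ = 0) (h1 : Dop h = v) (h2 : Pop (Aop h + Nop h) = κ₀) (p : X d) :
    h p = HBZd n a v p
      + ((∑' q : X d, Gk n a p q * (κ₀ - Pop (Nop h)) q)
        - HBZd n a (fun y => (((n : ℝ) + 1) ^ d)⁻¹ * ∑ p' ∈ B n y,
            ∑' q : X d, Gk n a p' q * (κ₀ - Pop (Nop h)) q) p) := by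
  obtain ⟨Dop₁, Aop₁, Pop₁, hD₁, hA₁, hP₁, -, -, Rop, hRapp, T, hT, hTsymm, -⟩ := exists_aug_equiv_sup hd n ha
  -- operators with the same displayed action agree
  have eD : ∀ f : lp (fun _ : X d => ℝ) ∞, Dop₁ f = Dop f := fun f => lp.ext (funext fun y => by rw [hD₁, hD])
  have eA : ∀ f : lp (fun _ : X d => ℝ) ∞, Aop₁ f = Aop f := fun f => lp.ext (funext fun q => by rw [hA₁, hA])
  have eP : ∀ f : lp (fun _ : X d => ℝ) ∞, Pop₁ f = Pop f := fun f => lp.ext (funext fun q => by rw [hP₁, hP])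
  -- the shifted fibre datum lies in `ker Q′`
  have hmem : κ₀ - Pop (Nop h) ∈ Dop₁.ker := by
    have e : Dop₁ (κ₀ - Pop (Nop h)) = 0 := by rw [map_sub, eD, eD, hκ₀, blockAvg_fibreProj hD hP, sub_zero]
    exact LinearMap.mem_ker.2 e
  have hR : Rop h = ⟨κ₀ - Pop (Nop h), hmem⟩ := by
    apply Subtype.ext
    rw [hRapp, eA, eP, eq_sub_iff_add_eq, ← map_add, h2]
  have hTh : T h = (v, ⟨κ₀ - Pop (Nop h), hmem⟩) := by rw [hT, eD, h1, hR]
  have hh : h = T.symm (v, ⟨κ₀ - Pop (Nop h), hmem⟩) := by rw [← hTh, ContinuousLinearEquiv.symm_apply_apply]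
  conv_lhs => rw [hh]
  exact hTsymm v ⟨κ₀ - Pop (Nop h), hmem⟩ p

/-- **THE WEIGHTED A-PRIORI LETTER** (`d ≥ 3`, `0 ≤ μ < δ_H`, `μ < δ_u∕4`, `2λC_Γ(μ) < 1`; `ρ` bounded with `ρ x − ρ y ≤ |x − y|`): every
`ℓ^∞` solution of `Q′h = v`, `P(Ah + N′h) = κ₀` (`Q′κ₀ = 0`, `N′` = multiplication by `g`, `|g| ≤ λ`) satisfies
`e^{μρ(blk p)}|h(p)| ≤ (1 − 2λC_Γ(μ))⁻¹·(C_H(μ)R_v + C_Γ(μ)R_κ)` at every `p`, whenever `e^{μρ(y)}|v(y)| ≤ R_v` and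
`e^{μρ(blk q)}|κ₀(q)| ≤ R_κ` — the background response and the fluctuation covariance are bounded between the WEIGHTED sup spaces.
[folklore] -/
theorem weighted_apriori (hd : 3 ≤ d) (n : ℕ) {a : ℝ} (ha : 0 < a)
    (Dop Aop Pop Nop : lp (fun _ : X d => ℝ) ∞ →L[ℝ] lp (fun _ : X d => ℝ) ∞)
    (hD : ∀ (f : lp (fun _ : X d => ℝ) ∞) (y : X d), Dop f y = (((n : ℝ) + 1) ^ d)⁻¹ * ∑ p ∈ B n y, f p)
    (hA : ∀ (f : lp (fun _ : X d => ℝ) ∞) (p : X d), Aop f p = ∑ r ∈ nbhd n p, AX n a p r * f r)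
    (hP : ∀ (f : lp (fun _ : X d => ℝ) ∞) (p : X d), Pop f p = f p - (((n : ℝ) + 1) ^ d)⁻¹ * ∑ p' ∈ B n (blk n p), f p')
    {g : X d → ℝ} {lam : ℝ} (hN : ∀ (f : lp (fun _ : X d => ℝ) ∞) (p : X d), Nop f p = g p * f p) (hg : ∀ p, |g p| ≤ lam)
    {μ : ℝ} (hμ0 : 0 ≤ μ) (hμH : μ < deltaH d a) (hμU : μ < deltaU d a / 4)
    (hsmall : 2 * lam * (((cG0 d * cKL d (d - 2) + cSplit d a) * Real.exp (2 * deltaU d a)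
        + cFar d a * Real.exp (4 * deltaU d a) / deltaU d a ^ 2) * latticeConst d (deltaU d a / 4 - μ)
          * (1 + cHs d a * latticeConst d (deltaH d a - μ))) < 1)
    {ρ : X d → ℝ} (hρ : ∀ x y, ρ x - ρ y ≤ dist x y) {Mρ : ℝ} (hρb : ∀ y, |ρ y| ≤ Mρ)
    (h v κ₀ : lp (fun _ : X d => ℝ) ∞) (hκ₀ : Dop κ₀ = 0) (h1 : Dop h = v) (h2 : Pop (Aop h + Nop h) = κ₀)
    {Rv Rκ : ℝ} (hv : ∀ y, Real.exp (μ * ρ y) * |v y| ≤ Rv) (hκ : ∀ q, Real.exp (μ * ρ (blk n q)) * |κ₀ q| ≤ Rκ) (p : X d) :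
    Real.exp (μ * ρ (blk n p)) * |h p|
      ≤ (1 - 2 * lam * (((cG0 d * cKL d (d - 2) + cSplit d a) * Real.exp (2 * deltaU d a)
            + cFar d a * Real.exp (4 * deltaU d a) / deltaU d a ^ 2) * latticeConst d (deltaU d a / 4 - μ)
              * (1 + cHs d a * latticeConst d (deltaH d a - μ))))⁻¹
        * (cHs d a * latticeConst d (deltaH d a - μ) * Rv
          + ((cG0 d * cKL d (d - 2) + cSplit d a) * Real.exp (2 * deltaU d a)
              + cFar d a * Real.exp (4 * deltaU d a) / deltaU d a ^ 2) * latticeConst d (deltaU d a / 4 - μ)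
                * (1 + cHs d a * latticeConst d (deltaH d a - μ)) * Rκ) := by
  haveI : Nonempty (X d) := ⟨fun _ => 0⟩
  have hlam : 0 ≤ lam := (abs_nonneg _).trans (hg 0)
  have hCH : 0 ≤ cHs d a * latticeConst d (deltaH d a - μ) :=
    mul_nonneg (cHs_nonneg d ha) (latticeConst_nonneg d (sub_pos.2 hμH).le)
  have hCΓ : 0 ≤ ((cG0 d * cKL d (d - 2) + cSplit d a) * Real.exp (2 * deltaU d a)
      + cFar d a * Real.exp (4 * deltaU d a) / deltaU d a ^ 2) * latticeConst d (deltaU d a / 4 - μ)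
        * (1 + cHs d a * latticeConst d (deltaH d a - μ)) :=
    mul_nonneg (mul_nonneg (supConstG_nonneg d ha) (latticeConst_nonneg d (sub_pos.2 hμU).le)) (by linarith)
  have hRv : 0 ≤ Rv := nonneg_of_weighted (g := id) hv
  have hRκ : 0 ≤ Rκ := nonneg_of_weighted hκ
  -- the weighted size `S` of `h`: a supremum with its two properties
  have hbdd : BddAbove (Set.range fun q : X d => Real.exp (μ * ρ (blk n q)) * |h q|) := by
    refine ⟨Real.exp (μ * Mρ) * ‖h‖, ?_⟩
    rintro _ ⟨q, rfl⟩
    have h1 : Real.exp (μ * ρ (blk n q)) ≤ Real.exp (μ * Mρ) :=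
      Real.exp_le_exp.2 (mul_le_mul_of_nonneg_left ((le_abs_self _).trans (hρb _)) hμ0)
    exact mul_le_mul h1 (abs_apply_le_norm h q) (abs_nonneg _) (Real.exp_pos _).le
  obtain ⟨S, hS, hSle⟩ : ∃ S : ℝ, (∀ q, Real.exp (μ * ρ (blk n q)) * |h q| ≤ S) ∧
      ∀ C : ℝ, (∀ q, Real.exp (μ * ρ (blk n q)) * |h q| ≤ C) → S ≤ C :=
    ⟨⨆ q : X d, Real.exp (μ * ρ (blk n q)) * |h q|, fun q => le_ciSup hbdd q, fun C hC => ciSup_le hC⟩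
  have hS0 : 0 ≤ S := (mul_nonneg (Real.exp_pos _).le (abs_nonneg _)).trans (hS 0)
  -- the shifted fibre datum `κ₁ := κ₀ − P(N′h)` has weighted size `≤ R_κ + 2λS` and is bounded
  have hκ₁b : ∀ q, |(κ₀ - Pop (Nop h)) q| ≤ ‖κ₀ - Pop (Nop h)‖ := fun q => abs_apply_le_norm _ q
  have hgh : ∀ q, Real.exp (μ * ρ (blk n q)) * |g q * h q| ≤ lam * S := fun q => by
    rw [abs_mul, mul_left_comm]
    exact mul_le_mul (hg q) (hS q) (mul_nonneg (Real.exp_pos _).le (abs_nonneg _)) hlam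
  have hκ₁ : ∀ q, Real.exp (μ * ρ (blk n q)) * |(κ₀ - Pop (Nop h)) q| ≤ Rκ + 2 * lam * S := by
    intro q
    have hE : 0 ≤ Real.exp (μ * ρ (blk n q)) := (Real.exp_pos _).le
    have havg := weighted_blockAvg n (ρ := ρ) (f := fun p' => g p' * h p') hgh (blk n q)
    have hNq : ∀ p', Nop h p' = g p' * h p' := fun p' => hN h p'
    rw [lp.coeFn_sub, Pi.sub_apply, hP]
    simp only [hNq]
    calc _ ≤ Real.exp (μ * ρ (blk n q)) * (|κ₀ q| + (|g q * h q|
            + |(((n : ℝ) + 1) ^ d)⁻¹ * ∑ p' ∈ B n (blk n q), g p' * h p'|)) := by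
          refine mul_le_mul_of_nonneg_left ((abs_sub _ _).trans (add_le_add le_rfl (abs_sub _ _))) hE
      _ = Real.exp (μ * ρ (blk n q)) * |κ₀ q| + (Real.exp (μ * ρ (blk n q)) * |g q * h q|
            + Real.exp (μ * ρ (blk n q)) * |(((n : ℝ) + 1) ^ d)⁻¹ * ∑ p' ∈ B n (blk n q), g p' * h p'|) := by ring
      _ ≤ Rκ + (lam * S + lam * S) := add_le_add (hκ q) (add_le_add (hgh q) havg)
      _ = Rκ + 2 * lam * S := by ring
  -- the displayed inverse, weighted ((62)), at every site; then the bootstrap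
  have hpt : ∀ q, Real.exp (μ * ρ (blk n q)) * |h q|
      ≤ cHs d a * latticeConst d (deltaH d a - μ) * Rv
        + ((cG0 d * cKL d (d - 2) + cSplit d a) * Real.exp (2 * deltaU d a)
            + cFar d a * Real.exp (4 * deltaU d a) / deltaU d a ^ 2) * latticeConst d (deltaU d a / 4 - μ)
              * (1 + cHs d a * latticeConst d (deltaH d a - μ)) * (Rκ + 2 * lam * S) := by
    intro q
    rw [eq_augInverse_of_solution hd n ha Dop Aop Pop Nop hD hA hP h v κ₀ hκ₀ h1 h2 q]
    exact weighted_augInverse hd n ha hμ0 hμH hμU hρ hv hκ₁b hκ₁ q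
  have hSb := hSle _ hpt
  have hpos : 0 < 1 - 2 * lam * (((cG0 d * cKL d (d - 2) + cSplit d a) * Real.exp (2 * deltaU d a)
      + cFar d a * Real.exp (4 * deltaU d a) / deltaU d a ^ 2) * latticeConst d (deltaU d a / 4 - μ)
        * (1 + cHs d a * latticeConst d (deltaH d a - μ))) := sub_pos.2 hsmall
  have hS' : S ≤ (1 - 2 * lam * (((cG0 d * cKL d (d - 2) + cSplit d a) * Real.exp (2 * deltaU d a)
      + cFar d a * Real.exp (4 * deltaU d a) / deltaU d a ^ 2) * latticeConst d (deltaU d a / 4 - μ)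
        * (1 + cHs d a * latticeConst d (deltaH d a - μ))))⁻¹
        * (cHs d a * latticeConst d (deltaH d a - μ) * Rv
          + ((cG0 d * cKL d (d - 2) + cSplit d a) * Real.exp (2 * deltaU d a)
              + cFar d a * Real.exp (4 * deltaU d a) / deltaU d a ^ 2) * latticeConst d (deltaU d a / 4 - μ)
                * (1 + cHs d a * latticeConst d (deltaH d a - μ)) * Rκ) := by
    rw [le_inv_mul_iff₀ hpos]
    nlinarith
  exact (hS p).trans hS'

/-! ## §2. The fibre equation of the background response, by differentiation -/

/-- **THE FIBRE EQUATION OF THE BACKGROUND RESPONSE** (every `d`): if `σ` satisfies (60)'s sitewise background equation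
`A(σ w′)(p) + u(σ w′(p)) = |B|⁻¹ Σ_{p′ ∈ B(blk p)} (A(σ w′)(p′) + u(σ w′(p′)))` for `w′` in a neighbourhood of `w` and
`HasFDerivAt σ D w`, then there is the diagonal operator `N′` (multiplication by `u′∘σ w`) with `P(A(Dv) + N′(Dv)) = 0` for every
`v` — differentiate `P(A(σ ·) + u∘σ ·) ≡ 0` at `w` ((58)'s `C¹` Nemytskii map, chain rule, uniqueness of the derivative). [folklore] -/
theorem fibre_eq_of_hasFDerivAt (n : ℕ)
    (Aop Pop : lp (fun _ : X d => ℝ) ∞ →L[ℝ] lp (fun _ : X d => ℝ) ∞)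
    (hP : ∀ (f : lp (fun _ : X d => ℝ) ∞) (p : X d), Pop f p = f p - (((n : ℝ) + 1) ^ d)⁻¹ * ∑ p' ∈ B n (blk n p), f p')
    {u u' : ℝ → ℝ} (hu : ∀ t, HasDerivAt u (u' t) t) {lam : ℝ} (hlam : ∀ t, |u' t| ≤ lam)
    {L : ℝ} (hL0 : 0 ≤ L) (hL : ∀ s t, |u' s - u' t| ≤ L * |s - t|)
    {σ : lp (fun _ : X d => ℝ) ∞ → lp (fun _ : X d => ℝ) ∞} {U : Set (lp (fun _ : X d => ℝ) ∞)}
    {w : lp (fun _ : X d => ℝ) ∞} (hU : U ∈ 𝓝 w)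
    (hσ : ∀ w' ∈ U, ∀ p : X d, Aop (σ w') p + u (σ w' p)
      = (((n : ℝ) + 1) ^ d)⁻¹ * ∑ p' ∈ B n (blk n p), (Aop (σ w') p' + u (σ w' p')))
    {D : lp (fun _ : X d => ℝ) ∞ →L[ℝ] lp (fun _ : X d => ℝ) ∞} (hD : HasFDerivAt σ D w) :
    ∃ Nop : lp (fun _ : X d => ℝ) ∞ →L[ℝ] lp (fun _ : X d => ℝ) ∞,
      (∀ (f : lp (fun _ : X d => ℝ) ∞) (p : X d), Nop f p = u' (σ w p) * f p) ∧
      ∀ v : lp (fun _ : X d => ℝ) ∞, Pop (Aop (D v) + Nop (D v)) = 0 := by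
  obtain ⟨Nu, N', hNu, hN', hNd, -, -⟩ := exists_nemytskii (ι := X d) hu ((abs_nonneg _).trans (hlam 0)) hlam hL0 hL
  refine ⟨N' (σ w), fun f p => hN' (σ w) f p, fun v => ?_⟩
  -- `Φ := P ∘ (A + Nu)` is differentiable with derivative `P ∘ (A + N′φ)`
  have hΦ : ∀ φ : lp (fun _ : X d => ℝ) ∞,
      HasFDerivAt (fun ψ => Pop (Aop ψ + Nu ψ)) (Pop.comp (Aop + N' φ)) φ := fun φ =>
    Pop.hasFDerivAt.comp φ (Aop.hasFDerivAt.add (hNd φ))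
  -- `Φ ∘ σ` vanishes near `w`
  have hzero : (fun w' => Pop (Aop (σ w') + Nu (σ w'))) =ᶠ[𝓝 w] fun _ => 0 := by
    filter_upwards [hU] with w' hw'
    refine lp.ext (funext fun p => ?_)
    rw [hP, lp.coeFn_add, Pi.add_apply, hNu, lp.coeFn_zero, Pi.zero_apply, sub_eq_zero, hσ w' hw' p]
    exact congrArg _ (Finset.sum_congr rfl fun p' _ => by rw [Pi.add_apply, hNu])
  have h1 : HasFDerivAt (fun w' => Pop (Aop (σ w') + Nu (σ w'))) ((Pop.comp (Aop + N' (σ w))).comp D) w :=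
    (hΦ (σ w)).comp w hD
  have h2 : HasFDerivAt (fun w' => Pop (Aop (σ w') + Nu (σ w')))
      (0 : lp (fun _ : X d => ℝ) ∞ →L[ℝ] lp (fun _ : X d => ℝ) ∞) w :=
    (hasFDerivAt_const (0 : lp (fun _ : X d => ℝ) ∞) w).congr_of_eventuallyEq hzero
  have h3 := h1.unique h2
  have h4 := congrArg (fun T : lp (fun _ : X d => ℝ) ∞ →L[ℝ] lp (fun _ : X d => ℝ) ∞ => T v) h3
  simpa only [ContinuousLinearMap.comp_apply, _root_.add_apply, _root_.zero_apply] using h4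

/-! ## §3. Reading a weighted letter as localisation -/

/-- **LOCALISATION FROM THE WEIGHTED LETTER** (any `μ ≥ 0`): suppose a value `t` (think `h(p)`) obeys, for EVERY bounded weight
`ρ` with `ρ x − ρ y ≤ |x − y|`, the letter `e^{μρ(blk p)}|t| ≤ K·(C_v·R_v(ρ) + C_κ·R_κ(ρ))` with `R_v(ρ)`, `R_κ(ρ)` any weighted
bounds of the data `v` (coarse) and `κ₀` (fine); if `v` vanishes on the coarse ball `{y : |y − blk p| < D}` and `κ₀` on the blocks
over it, then `|t| ≤ K·(C_v‖v‖_∞ + C_κ‖κ₀‖_∞)·e^{−μD}` (weight `D − min(|· − blk p|, D)`). [folklore] -/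
theorem abs_le_of_far (n : ℕ) {μ : ℝ} (hμ0 : 0 ≤ μ) {K Cv Cκ : ℝ} (hK : 0 ≤ K) (hCv : 0 ≤ Cv) (hCκ : 0 ≤ Cκ)
    {v κ₀ : X d → ℝ} {Rv Rκ D t : ℝ} (hvb : ∀ y, |v y| ≤ Rv) (hκb : ∀ q, |κ₀ q| ≤ Rκ) (p : X d)
    (hvfar : ∀ y, dist y (blk n p) < D → v y = 0) (hκfar : ∀ q, dist (blk n q) (blk n p) < D → κ₀ q = 0)
    (hletter : ∀ ρ : X d → ℝ, (∀ x y, ρ x - ρ y ≤ dist x y) → (∃ M, ∀ y, |ρ y| ≤ M) →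
      ∀ Rv' Rκ' : ℝ, (∀ y, Real.exp (μ * ρ y) * |v y| ≤ Rv') → (∀ q, Real.exp (μ * ρ (blk n q)) * |κ₀ q| ≤ Rκ') →
        Real.exp (μ * ρ (blk n p)) * |t| ≤ K * (Cv * Rv' + Cκ * Rκ')) :
    |t| ≤ K * (Cv * Rv + Cκ * Rκ) * Real.exp (-(μ * D)) := by
  have hρ := lipschitz_trunc_dist (blk n p) D
  have hρb : ∃ M, ∀ y : X d, |D - min (dist y (blk n p)) D| ≤ M := by
    refine ⟨|D| + |D|, fun y => (abs_sub _ _).trans (add_le_add le_rfl ?_)⟩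
    rcases le_total (dist y (blk n p)) D with h | h
    · rw [min_eq_left h, abs_of_nonneg dist_nonneg]; exact h.trans (le_abs_self D)
    · rw [min_eq_right h]
  have hwt : ∀ (f : X d → ℝ) (R : ℝ) (g : X d → X d), (∀ x, |f x| ≤ R) → (∀ x, dist (g x) (blk n p) < D → f x = 0) →
      ∀ x, Real.exp (μ * (D - min (dist (g x) (blk n p)) D)) * |f x| ≤ R := by
    intro f R g hf hfar x
    by_cases hx : dist (g x) (blk n p) < D
    · rw [hfar x hx, abs_zero, mul_zero]; exact (abs_nonneg _).trans (hf x)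
    · rw [not_lt] at hx
      rw [min_eq_right hx, sub_self, mul_zero, Real.exp_zero, one_mul]; exact hf x
  have h := hletter _ hρ hρb Rv Rκ (hwt v Rv id hvb hvfar) (hwt κ₀ Rκ (blk n) hκb hκfar)
  have h' := abs_le_exp_neg_mul (μ := μ) (ρ := fun x => D - min (dist x (blk n p)) D) (blk n p) h
  have hρp : D ≤ D - min (dist (blk n p) (blk n p)) D := by
    rw [dist_self]; have := min_le_left (0 : ℝ) D; linarith
  have hexp : Real.exp (-(μ * (D - min (dist (blk n p) (blk n p)) D))) ≤ Real.exp (-(μ * D)) :=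
    Real.exp_le_exp.2 (neg_le_neg (mul_le_mul_of_nonneg_left hρp hμ0))
  have hRv : 0 ≤ Rv := (abs_nonneg _).trans (hvb 0)
  have hRκ : 0 ≤ Rκ := (abs_nonneg _).trans (hκb 0)
  have hB0 : 0 ≤ K * (Cv * Rv + Cκ * Rκ) := by positivity
  exact h'.trans (mul_le_mul_of_nonneg_left hexp hB0)


/-! ## §4. The background response and the fluctuation covariance of the perturbed skeleton, localised -/

/-- **THE BACKGROUND RESPONSE AND THE FLUCTUATION COVARIANCE AT THE BACKGROUND, LOCALISED** (`d ≥ 3`; (60) v1.1's hypotheses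
verbatim).  (60) v1.1 `exists_background_covariance` RE-EXPORTED — `Q′, A, P, N′, σ, C̃` with displayed actions, the closed-ball
letters, Lipschitz, and on the interior ball `D = Dσ(w)` with `‖D‖ ≤ (N⁻¹ − c)⁻¹`, `Q′∘D = 1`, the covariance `C̃(w)`'s fibre
equation, uniqueness, sizes and modulus — AND, new, on the interior ball: the FIBRE EQUATION OF THE RESPONSE
`P(A(Dv) + N′(σ w)(Dv)) = 0` (§2), and for every rate `0 ≤ μ < δ_H`, `μ < δ_u∕4` with `2λC_Γ(μ) < 1` and every bounded weight `ρ` with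
`ρ x − ρ y ≤ |x − y|`: **`e^{μρ(blk p)}|(Dv)(p)| ≤ (1 − 2λC_Γ(μ))⁻¹·C_H(μ)·R_v`** whenever `e^{μρ(y)}|v(y)| ≤ R_v`, and
**`e^{μρ(blk p)}|(C̃(w)f)(p)| ≤ (1 − 2λC_Γ(μ))⁻¹·C_Γ(μ)·2R_f`** whenever `e^{μρ(blk q)}|f(q)| ≤ R_f` (§1) — by §3 both are
exponentially localised at the block scale, uniformly in `w` on the interior ball and in the radius. [folklore] -/
theorem exists_background_covariance_localised (hd : 3 ≤ d) (n : ℕ) {a : ℝ} (ha : 0 < a)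
    {u u' : ℝ → ℝ} (hu : ∀ t, HasDerivAt u (u' t) t) (hu0 : u 0 = 0) {lam c N : ℝ≥0} (hlam : ∀ t, |u' t| ≤ lam)
    {L : ℝ} (hL0 : 0 ≤ L) (hL : ∀ s t, |u' s - u' t| ≤ L * |s - t|)
    (hN : cHs d a * latticeConst d (deltaH d a)
        + ((cG0 d * cKL d (d - 2) + cSplit d a) * Real.exp (2 * deltaU d a)
            + cFar d a * Real.exp (4 * deltaU d a) / deltaU d a ^ 2) * latticeConst d (deltaU d a / 4)
          * (1 + cHs d a * latticeConst d (deltaH d a)) ≤ (N : ℝ))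
    (hc : 2 * lam ≤ c) (hcN : c < N⁻¹) {r : ℝ} (hr : 0 ≤ r) :
    ∃ (Dop Aop Pop : lp (fun _ : X d => ℝ) ∞ →L[ℝ] lp (fun _ : X d => ℝ) ∞)
      (N' : lp (fun _ : X d => ℝ) ∞ → (lp (fun _ : X d => ℝ) ∞ →L[ℝ] lp (fun _ : X d => ℝ) ∞))
      (σ : lp (fun _ : X d => ℝ) ∞ → lp (fun _ : X d => ℝ) ∞)
      (Cf : lp (fun _ : X d => ℝ) ∞ → (lp (fun _ : X d => ℝ) ∞ →L[ℝ] lp (fun _ : X d => ℝ) ∞)),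
      (∀ (f : lp (fun _ : X d => ℝ) ∞) (y : X d), Dop f y = (((n : ℝ) + 1) ^ d)⁻¹ * ∑ p ∈ B n y, f p) ∧
      (∀ (f : lp (fun _ : X d => ℝ) ∞) (p : X d), Aop f p = ∑ r ∈ nbhd n p, AX n a p r * f r) ∧
      (∀ (f : lp (fun _ : X d => ℝ) ∞) (p : X d), Pop f p = f p - (((n : ℝ) + 1) ^ d)⁻¹ * ∑ p' ∈ B n (blk n p), f p') ∧
      (∀ (φ h : lp (fun _ : X d => ℝ) ∞) (p : X d), N' φ h p = u' (φ p) * h p) ∧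
      σ 0 = 0 ∧
      (∀ w ∈ closedBall (0 : lp (fun _ : X d => ℝ) ∞) (((N : ℝ)⁻¹ - c) * r),
        σ w ∈ closedBall 0 r ∧ Dop (σ w) = w ∧
          ∀ p : X d, Aop (σ w) p + u (σ w p)
            = (((n : ℝ) + 1) ^ d)⁻¹ * ∑ p' ∈ B n (blk n p), (Aop (σ w) p' + u (σ w p'))) ∧
      LipschitzOnWith (N⁻¹ - c)⁻¹ σ (closedBall (0 : lp (fun _ : X d => ℝ) ∞) (((N : ℝ)⁻¹ - c) * r)) ∧
      (∀ w ∈ ball (0 : lp (fun _ : X d => ℝ) ∞) (((N : ℝ)⁻¹ - c) * r),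
        (∃ D : lp (fun _ : X d => ℝ) ∞ →L[ℝ] lp (fun _ : X d => ℝ) ∞,
          HasFDerivAt σ D w ∧ ‖D‖ ≤ ((N : ℝ)⁻¹ - c)⁻¹ ∧ Dop.comp D = ContinuousLinearMap.id ℝ (lp (fun _ : X d => ℝ) ∞) ∧
          (∀ v : lp (fun _ : X d => ℝ) ∞, Pop (Aop (D v) + N' (σ w) (D v)) = 0) ∧
          (∀ μ : ℝ, 0 ≤ μ → μ < deltaH d a → μ < deltaU d a / 4 →
            2 * (lam : ℝ) * (((cG0 d * cKL d (d - 2) + cSplit d a) * Real.exp (2 * deltaU d a)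
                + cFar d a * Real.exp (4 * deltaU d a) / deltaU d a ^ 2) * latticeConst d (deltaU d a / 4 - μ)
                  * (1 + cHs d a * latticeConst d (deltaH d a - μ))) < 1 →
            ∀ ρ : X d → ℝ, (∀ x y, ρ x - ρ y ≤ dist x y) → (∃ M : ℝ, ∀ y, |ρ y| ≤ M) →
            ∀ (v : lp (fun _ : X d => ℝ) ∞) (Rv : ℝ), (∀ y, Real.exp (μ * ρ y) * |v y| ≤ Rv) →
            ∀ p : X d, Real.exp (μ * ρ (blk n p)) * |D v p|
              ≤ (1 - 2 * (lam : ℝ) * (((cG0 d * cKL d (d - 2) + cSplit d a) * Real.exp (2 * deltaU d a)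
                    + cFar d a * Real.exp (4 * deltaU d a) / deltaU d a ^ 2) * latticeConst d (deltaU d a / 4 - μ)
                      * (1 + cHs d a * latticeConst d (deltaH d a - μ))))⁻¹
                * (cHs d a * latticeConst d (deltaH d a - μ) * Rv))) ∧
        (∀ g : lp (fun _ : X d => ℝ) ∞, Dop (Cf w g) = 0) ∧
        (∀ g : lp (fun _ : X d => ℝ) ∞, Pop (Aop (Cf w g) + N' (σ w) (Cf w g)) = Pop g) ∧
        (∀ g h : lp (fun _ : X d => ℝ) ∞, Dop h = 0 → Pop (Aop h + N' (σ w) h) = Pop g → h = Cf w g) ∧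
        (∀ g : lp (fun _ : X d => ℝ) ∞, ‖Cf w g‖ ≤ 2 * ((N : ℝ)⁻¹ - c)⁻¹ * ‖g‖) ∧
        (∀ g : lp (fun _ : X d => ℝ) ∞, Dop g = 0 → ‖Cf w g‖ ≤ ((N : ℝ)⁻¹ - c)⁻¹ * ‖g‖) ∧
        (∀ μ : ℝ, 0 ≤ μ → μ < deltaH d a → μ < deltaU d a / 4 →
          2 * (lam : ℝ) * (((cG0 d * cKL d (d - 2) + cSplit d a) * Real.exp (2 * deltaU d a)
              + cFar d a * Real.exp (4 * deltaU d a) / deltaU d a ^ 2) * latticeConst d (deltaU d a / 4 - μ)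
                * (1 + cHs d a * latticeConst d (deltaH d a - μ))) < 1 →
          ∀ ρ : X d → ℝ, (∀ x y, ρ x - ρ y ≤ dist x y) → (∃ M : ℝ, ∀ y, |ρ y| ≤ M) →
          ∀ (f : lp (fun _ : X d => ℝ) ∞) (Rf : ℝ), (∀ q, Real.exp (μ * ρ (blk n q)) * |f q| ≤ Rf) →
          ∀ p : X d, Real.exp (μ * ρ (blk n p)) * |Cf w f p|
            ≤ (1 - 2 * (lam : ℝ) * (((cG0 d * cKL d (d - 2) + cSplit d a) * Real.exp (2 * deltaU d a)
                  + cFar d a * Real.exp (4 * deltaU d a) / deltaU d a ^ 2) * latticeConst d (deltaU d a / 4 - μ)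
                    * (1 + cHs d a * latticeConst d (deltaH d a - μ))))⁻¹
              * (((cG0 d * cKL d (d - 2) + cSplit d a) * Real.exp (2 * deltaU d a)
                  + cFar d a * Real.exp (4 * deltaU d a) / deltaU d a ^ 2) * latticeConst d (deltaU d a / 4 - μ)
                    * (1 + cHs d a * latticeConst d (deltaH d a - μ)) * (2 * Rf)))) ∧
      (∀ w ∈ ball (0 : lp (fun _ : X d => ℝ) ∞) (((N : ℝ)⁻¹ - c) * r),
        ∀ w' ∈ ball (0 : lp (fun _ : X d => ℝ) ∞) (((N : ℝ)⁻¹ - c) * r), ∀ g : lp (fun _ : X d => ℝ) ∞,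
          ‖Cf w g - Cf w' g‖ ≤ ((N : ℝ)⁻¹ - c)⁻¹ ^ 3 * (4 * L) * ‖w - w'‖ * ‖g‖) := by
  obtain ⟨Dop, Aop, Pop, N', σ, Cf, hD, hA, hP, hN'app, hσ0, hσ, hlip, hint, hmod⟩ :=
    exists_background_covariance hd n ha hu hu0 hlam hL0 hL hN hc hcN hr
  refine ⟨Dop, Aop, Pop, N', σ, Cf, hD, hA, hP, hN'app, hσ0, hσ, hlip, fun w hw => ?_, hmod⟩
  obtain ⟨⟨D, hDσ, hDn, hDD⟩, hC1, hC2, hC3, hC4, hC5⟩ := hint w hw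
  have hg : ∀ p : X d, |u' (σ w p)| ≤ (lam : ℝ) := fun p => hlam _
  -- the fibre equation of the response (§2), on the closed ball as a neighbourhood of `w`
  have hU : closedBall (0 : lp (fun _ : X d => ℝ) ∞) (((N : ℝ)⁻¹ - c) * r) ∈ 𝓝 w :=
    mem_of_superset (isOpen_ball.mem_nhds hw) ball_subset_closedBall
  obtain ⟨Nop, hNop, hfib⟩ := fibre_eq_of_hasFDerivAt n Aop Pop hP hu hlam hL0 hL hU
    (fun w' hw' => (hσ w' hw').2.2) hDσ
  have hNN : ∀ f : lp (fun _ : X d => ℝ) ∞, N' (σ w) f = Nop f := fun f =>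
    lp.ext (funext fun p => by rw [hN'app, hNop])
  have hfib' : ∀ v : lp (fun _ : X d => ℝ) ∞, Pop (Aop (D v) + N' (σ w) (D v)) = 0 := fun v => by
    rw [hNN]; exact hfib v
  have hz : ∀ (μ : ℝ) (ρ' : X d → ℝ) (y : X d), Real.exp (μ * ρ' y) * |(0 : lp (fun _ : X d => ℝ) ∞) y| ≤ 0 :=
    fun μ ρ' y => by rw [lp.coeFn_zero, Pi.zero_apply, abs_zero, mul_zero]
  refine ⟨⟨D, hDσ, hDn, hDD, hfib', fun μ hμ0 hμH hμU hsm ρ hρ hρb v Rv hv p => ?_⟩, hC1, hC2, hC3, hC4, hC5,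
    fun μ hμ0 hμH hμU hsm ρ hρ hρb f Rf hf p => ?_⟩
  · -- the response `Dv`: `Q′(Dv) = v`, fibre datum `0`
    obtain ⟨M, hM⟩ := hρb
    have h1 : Dop (D v) = v := by
      have e := congrArg (fun T : lp (fun _ : X d => ℝ) ∞ →L[ℝ] lp (fun _ : X d => ℝ) ∞ => T v) hDD
      simpa using e
    have h := weighted_apriori hd n ha Dop Aop Pop (N' (σ w)) hD hA hP (hN'app (σ w)) hg hμ0 hμH hμU hsm hρ hM
      (D v) v 0 (map_zero Dop) h1 (hfib' v) hv (hz μ (fun q => ρ (blk n q))) p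
    rw [mul_zero, add_zero] at h; exact h
  · -- the covariance `C̃(w)f`: `Q′(C̃f) = 0`, fibre datum `Pf` of weighted size `≤ 2R_f`
    obtain ⟨M, hM⟩ := hρb
    have hκ : ∀ q, Real.exp (μ * ρ (blk n q)) * |Pop f q| ≤ 2 * Rf := fun q => by
      have havg := weighted_blockAvg n (μ := μ) (ρ := ρ) hf (blk n q)
      have hE : 0 ≤ Real.exp (μ * ρ (blk n q)) := (Real.exp_pos _).le
      rw [hP]
      calc _ ≤ Real.exp (μ * ρ (blk n q)) * (|f q| + |(((n : ℝ) + 1) ^ d)⁻¹ * ∑ p' ∈ B n (blk n q), f p'|) :=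
            mul_le_mul_of_nonneg_left (abs_sub _ _) hE
        _ ≤ Rf + Rf := by rw [mul_add]; exact add_le_add (hf q) havg
        _ = 2 * Rf := by ring
    have h := weighted_apriori hd n ha Dop Aop Pop (N' (σ w)) hD hA hP (hN'app (σ w)) hg hμ0 hμH hμU hsm hρ hM
      (Cf w f) 0 (Pop f) (blockAvg_fibreProj hD hP f) (hC1 f) (hC2 f) (hz μ ρ) hκ p
    rw [mul_zero, zero_add] at h; exact h

end Summit.QuantumFields.BalabanUV.T4Continuum.NE7b.SupBackgroundLocalisation

end
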